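import Summits.Ventures.PercRepro.ProfileGapMonoQ

/-!
# PercRepro — THE GAP-MONOTONICITY CONJECTURE AT A LOOP: loops are free (p10, gen 7; `proofs/P10-AVFULL.md` §13)

For a loop `ℓ` of `N` every subset `X` and `X ∪ ℓ` have the same rank and the same complement rank, so
`D_q(N; u) = 2 · D_q(N ∖ ℓ; u)` and `W⁻_{q,u}(N) = 2 · W⁻_{q,u}(N ∖ ℓ)` (`sum_demand_loop`, `card_levelSetCoQ_loop`), and
`GapMonoQ N ℓ q u` is exactly the co-rank-`q` row of `N ∖ ℓ` (`gapMonoQ_of_loop`).  In the induction of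
`profileIneqMinusQ_of_gapMonoRuleQ` the row of `N ∖ ℓ` is the induction hypothesis: a matroid with a loop always
has a gap-monotone point.

* `rk_insert_of_loop`, `rk_erase_of_loop`, `Rq_loop_split`, `sum_demand_loop`, `card_levelSetCoQ_loop`,
  **`gapMonoQ_of_loop`**.
-/

open scoped Matroid

namespace PercRepro.Cogirth

open Finset ThmH Skew Shadow Profile

variable {α : Type} [DecidableEq α] {N : Matroid α} [N.Finite]

/-- A loop lies in the closure of every subset of the ground set, so inserting it keeps the rank. -/
theorem rk_insert_of_loop {ℓ : α} (hℓ : ℓ ∈ gr N) (h0 : rk N {ℓ} = 0) {X : Finset α} (hX : X ⊆ gr N) :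
    rk N (insert ℓ X) = rk N X := by
  have hcl0 : ℓ ∈ clF N ∅ := by
    rw [mem_clF_iff_rk_insert_eq hℓ (empty_subset _), insert_empty, h0]
    have : rk N ∅ ≤ (∅ : Finset α).card := rk_le_card _
    rw [card_empty] at this
    omega
  have hcl : ℓ ∈ clF N X := clF_mono_sub (empty_subset X) hcl0
  rw [rk_insert_eq hℓ hX, if_pos hcl]

/-- Erasing a loop keeps the rank. -/
theorem rk_erase_of_loop {ℓ : α} (hℓ : ℓ ∈ gr N) (h0 : rk N {ℓ} = 0) {X : Finset α} (hX : X ⊆ gr N) :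
    rk N (X.erase ℓ) = rk N X := by
  by_cases hℓX : ℓ ∈ X
  · have h := rk_insert_of_loop hℓ h0 (X := X.erase ℓ) ((erase_subset _ _).trans hX)
    rw [insert_erase hℓX] at h
    exact h.symm
  · rw [erase_eq_of_notMem hℓX]

/-- The demand in `N ∖ ℓ` of a set `B ∌ ℓ` equals its demand in `N` (`ℓ` a loop). -/
theorem demand_delete_loop_eq {ℓ : α} (hℓ : ℓ ∈ gr N) (h0 : rk N {ℓ} = 0) (q u : ℕ) (B : Finset α) :
    demand (N ＼ ({ℓ} : Set α)) q u B = demand N q u B := by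
  rw [demand_delete_eq_ite']
  unfold demand
  rw [rk_erase_of_loop hℓ h0 sdiff_subset]

/-- The demand in `N` of a set `B ∋ ℓ` equals the demand in `N ∖ ℓ` of `B ∖ ℓ`. -/
theorem demand_erase_loop_eq {ℓ : α} (hℓ : ℓ ∈ gr N) (h0 : rk N {ℓ} = 0) (q u : ℕ) {B : Finset α}
    (hℓB : ℓ ∈ B) : demand N q u B = demand (N ＼ ({ℓ} : Set α)) q u (B.erase ℓ) := by
  rw [demand_delete_loop_eq hℓ h0]
  unfold demand
  have hset : gr N \ B.erase ℓ = insert ℓ (gr N \ B) := by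
    ext x
    simp only [mem_sdiff, mem_erase, mem_insert, not_and]
    constructor
    · rintro ⟨hxE, hx⟩
      by_cases hxℓ : x = ℓ
      · exact Or.inl hxℓ
      · exact Or.inr ⟨hxE, fun hxB => hx hxℓ hxB⟩
    · rintro (rfl | ⟨hxE, hxB⟩)
      · exact ⟨hℓ, fun h _ => h rfl⟩
      · exact ⟨hxE, fun _ => hxB⟩
  rw [hset, rk_insert_of_loop hℓ h0 sdiff_subset]

/-- The rank-`q` sets of `N` through a loop `ℓ` are the rank-`q` sets of `N ∖ ℓ` with `ℓ` inserted. -/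
theorem sum_Rq_filter_mem_loop {ℓ : α} (hℓ : ℓ ∈ gr N) (h0 : rk N {ℓ} = 0) (q : ℕ) (f : Finset α → ℕ) :
    ∑ B ∈ (Rq N q).filter (fun B => ℓ ∈ B), f B = ∑ B ∈ Rq (N ＼ ({ℓ} : Set α)) q, f (insert ℓ B) := by
  rw [Rq_delete_eq_filter]
  refine sum_nbij' (fun B => B.erase ℓ) (fun B => insert ℓ B) ?_ ?_ ?_ ?_ ?_
  · intro B hB
    rw [mem_filter, mem_Rq] at hB ⊢
    obtain ⟨⟨hBg, hBr⟩, hℓB⟩ := hB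
    refine ⟨⟨(erase_subset _ _).trans hBg, ?_⟩, notMem_erase _ _⟩
    rw [← coe_rk, rk_erase_of_loop hℓ h0 hBg, coe_rk, hBr]
  · intro B hB
    rw [mem_filter, mem_Rq] at hB ⊢
    obtain ⟨⟨hBg, hBr⟩, hℓB⟩ := hB
    refine ⟨⟨insert_subset hℓ hBg, ?_⟩, mem_insert_self _ _⟩
    rw [← coe_rk, rk_insert_of_loop hℓ h0 hBg, coe_rk, hBr]
  · intro B hB
    rw [mem_filter] at hB
    exact insert_erase hB.2
  · intro B hB
    rw [mem_filter] at hB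
    exact erase_insert hB.2
  · intro B hB
    rw [mem_filter] at hB
    rw [insert_erase hB.2]

/-- **`D_q(N; u) = 2 · D_q(N ∖ ℓ; u)`** for a loop `ℓ`. -/
theorem sum_demand_loop {ℓ : α} (hℓ : ℓ ∈ gr N) (h0 : rk N {ℓ} = 0) (q u : ℕ) :
    ∑ B ∈ Rq N q, demand N q u B = 2 * ∑ B ∈ Rq (N ＼ ({ℓ} : Set α)) q, demand (N ＼ ({ℓ} : Set α)) q u B := by
  rw [← sum_filter_add_sum_filter_not (Rq N q) (fun B => ℓ ∈ B), sum_Rq_filter_mem_loop hℓ h0,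
    ← Rq_delete_eq_filter, two_mul]
  congr 1
  · apply sum_congr rfl
    intro B hB
    rw [demand_erase_loop_eq hℓ h0 q u (mem_insert_self _ _), erase_insert]
    rw [Rq_delete_eq_filter, mem_filter] at hB
    exact hB.2
  · apply sum_congr rfl
    intro B hB
    rw [demand_delete_loop_eq hℓ h0]

/-- **`W⁻_{q,u}(N) = 2 · W⁻_{q,u}(N ∖ ℓ)`** for a loop `ℓ`. -/
theorem card_levelSetCoQ_loop {ℓ : α} (hℓ : ℓ ∈ gr N) (h0 : rk N {ℓ} = 0) (q u : ℕ) :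
    (levelSetCoQ N q u).card = 2 * (levelSetCoQ (N ＼ ({ℓ} : Set α)) q u).card := by
  have hmem : ∀ S, S ∈ levelSetCoQ (N ＼ ({ℓ} : Set α)) q u ↔
      S ∈ levelSetCoQ N q u ∧ ℓ ∉ S := by
    intro S
    rw [mem_levelSetCoQ, mem_levelSetCoQ, gr_delete']
    have hsd : (gr N).erase ℓ \ S = (gr N \ S).erase ℓ := by
      ext x
      simp only [mem_sdiff, mem_erase]
      tauto
    have hrk2 : rk (N ＼ ({ℓ} : Set α)) ((gr N).erase ℓ \ S) = rk N (gr N \ S) := by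
      rw [rk_delete sdiff_subset, hsd, rk_erase_of_loop hℓ h0 sdiff_subset]
    constructor
    · rintro ⟨⟨hS, hr⟩, hq⟩
      have hS' := subset_erase.1 hS
      refine ⟨⟨⟨hS'.1, ?_⟩, ?_⟩, hS'.2⟩
      · rw [← coe_rk, rk_delete hS, coe_rk] at hr
        exact hr
      · rw [hrk2] at hq
        exact hq
    · rintro ⟨⟨⟨hS, hr⟩, hq⟩, hℓS⟩
      have hS' : S ⊆ (gr N).erase ℓ := subset_erase.2 ⟨hS, hℓS⟩
      refine ⟨⟨hS', ?_⟩, ?_⟩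
      · rw [← coe_rk, rk_delete hS', coe_rk]
        exact hr
      · rw [hrk2]
        exact hq
  rw [← card_filter_add_card_filter_not (s := levelSetCoQ N q u) (fun S => ℓ ∈ S), two_mul]
  have h1 : ((levelSetCoQ N q u).filter (fun S => ¬ ℓ ∈ S)).card = (levelSetCoQ (N ＼ ({ℓ} : Set α)) q u).card := by
    congr 1
    ext S
    rw [mem_filter, hmem]
  have h2 : ((levelSetCoQ N q u).filter (fun S => ℓ ∈ S)).card = (levelSetCoQ (N ＼ ({ℓ} : Set α)) q u).card := by
    apply card_bij (fun S _ => S.erase ℓ)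
    · intro S hS
      rw [mem_filter] at hS
      rw [hmem]
      refine ⟨?_, notMem_erase _ _⟩
      rw [mem_levelSetCoQ] at hS ⊢
      obtain ⟨⟨⟨hSg, hSr⟩, hq⟩, hℓS⟩ := hS
      refine ⟨⟨(erase_subset _ _).trans hSg, ?_⟩, ?_⟩
      · rw [← coe_rk, rk_erase_of_loop hℓ h0 hSg, coe_rk, hSr]
      · have hset : gr N \ S.erase ℓ = insert ℓ (gr N \ S) := by
          ext x
          simp only [mem_sdiff, mem_erase, mem_insert, not_and]
          constructor
          · rintro ⟨hxE, hx⟩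
            by_cases hxℓ : x = ℓ
            · exact Or.inl hxℓ
            · exact Or.inr ⟨hxE, fun hxS => hx hxℓ hxS⟩
          · rintro (rfl | ⟨hxE, hxS⟩)
            · exact ⟨hℓ, fun h _ => h rfl⟩
            · exact ⟨hxE, fun _ => hxS⟩
        rw [hset, rk_insert_of_loop hℓ h0 sdiff_subset]
        exact hq
    · intro S hS T hT hST
      rw [mem_filter] at hS hT
      rw [← insert_erase hS.2, ← insert_erase hT.2, hST]
    · intro T hT
      rw [hmem] at hT
      refine ⟨insert ℓ T, ?_, erase_insert hT.2⟩
      rw [mem_filter]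
      refine ⟨?_, mem_insert_self _ _⟩
      rw [mem_levelSetCoQ] at hT ⊢
      obtain ⟨⟨⟨hTg, hTr⟩, hq⟩, hℓT⟩ := hT
      refine ⟨⟨insert_subset hℓ hTg, ?_⟩, ?_⟩
      · rw [← coe_rk, rk_insert_of_loop hℓ h0 hTg, coe_rk, hTr]
      · have hset : gr N \ insert ℓ T = (gr N \ T).erase ℓ := by
          ext x
          simp only [mem_sdiff, mem_insert, mem_erase, not_or]
          tauto
        rw [hset, rk_erase_of_loop hℓ h0 sdiff_subset]
        exact hq
  rw [h1, h2]

/-- **Loops are free**: at a loop `ℓ`, `GapMonoQ N ℓ q u` is the co-rank-`q` row of `N ∖ ℓ`. -/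
theorem gapMonoQ_of_loop {ℓ : α} (hℓ : ℓ ∈ gr N) (h0 : rk N {ℓ} = 0) {q u : ℕ}
    (hdel : ProfileIneqMinusQ (N ＼ ({ℓ} : Set α)) q u) : GapMonoQ N ℓ q u := by
  unfold GapMonoQ
  unfold ProfileIneqMinusQ at hdel
  rw [sum_demand_loop hℓ h0, card_levelSetCoQ_loop hℓ h0]
  have : u.choose q * (2 * (levelSetCoQ (N ＼ ({ℓ} : Set α)) q u).card) =
      2 * (u.choose q * (levelSetCoQ (N ＼ ({ℓ} : Set α)) q u).card) := by ring
  omega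

end PercRepro.Cogirth
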